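import Summits.PneNP.PneNP.Theorems.SymmetryBudgetNoHiddenOrderPerPathCGProcess

/-!
# `NoHiddenOrder` (stmt-PneNP-14781), (R2c) value layer I: the BIT VALUATION of the certified scheme — definitions

Route `PneNP/SymmetryBudget`.  The certified-label scheme `CertifiedLabels.val` (`…CertifiedSchemeDefs.lean`) is
generic in its `Valuation`; `…PerPathCGProcess.lean` realises one (`cgValuation`, values = LISTS of rows, pasting =
`assembleAND` of an insertion-sorted list) whose list arithmetic a circuit cannot mirror gate by gate.  This file gives
the CIRCUIT-NATIVE valuation of the same process `cgProcess G`, the one the symmetric compilation realises literally: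

* values are BITVECTORS `BVal n = Fin (n·n + n·n) → Bool` — colour bits `cIdx i c` ("row `i` has colour `c`") and
  adjacency bits `aIdx i j` — compared in the lexicographic order of `Lex (Fin _ → Bool)` (the order the kit's
  `VecCmp`/`LexMin` gadgets compute);
* `bitEnc G n col s e` — the value of the coloured block read along the enumeration `e` of its first `s` rows;
  `IsEnum`; `Good` ("a copy read along an enumeration"; for instances with a colour `≥ n`, which the process never
  produces, `Good` is the trivial "equals the designated junk `leafVal`", so that the valuation axioms hold on EVERY
  instance of `cgProcess`);
* `leafVal` (read along `someEnum`), `lift` (colour read-back through the refined classes, bitwise), `paste` (rows of the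
  pasted copy are the rows of the parts laid out class by class in increasing value order — `ltCnt` rows of strictly
  smaller parts first, then `mult` copies of the common value of the class — with cross bits the colour-level switching
  datum `SwCompC`; every quantifier is over parts / rows / colours, i.e. an OR of gates), `pick` (lexicographic minimum).
The valuation axioms and the root theorem are in `SymmetryBudgetNoHiddenOrderBitValuation.lean`.
Definitions only; supports stmt-PneNP-14781.
-/

set_option linter.dupNamespace false -- `Summit.PneNP.PneNP.…` (D-0017 single-conjunct layout)

namespace Summit.PneNP.PneNP.Theorems

open Finset BranchSum

namespace CGBits

/-! ### Bit indices and values -/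

/-- Number of value bits at width `n`: `n·n` colour bits and `n·n` adjacency bits. [folklore] -/
def NB (n : ℕ) : ℕ := n * n + n * n

/-- VALUES: bitvectors of width `NB n`. [folklore] -/
abbrev BVal (n : ℕ) : Type := Fin (NB n) → Bool

/-- Decoding a bit index: a colour bit `(i, c)` ("row `i` has colour `c`") or an adjacency bit `(i, j)`. [folklore] -/
def bdec {n : ℕ} : Fin (NB n) ≃ (Fin n × Fin n) ⊕ (Fin n × Fin n) :=
  finSumFinEquiv.symm.trans (Equiv.sumCongr finProdFinEquiv.symm finProdFinEquiv.symm)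

/-- The colour bit "row `i` has colour `c`". [folklore] -/
def cIdx {n : ℕ} (i c : Fin n) : Fin (NB n) := bdec.symm (Sum.inl (i, c))

/-- The adjacency bit "rows `i` and `j` are adjacent". [folklore] -/
def aIdx {n : ℕ} (i j : Fin n) : Fin (NB n) := bdec.symm (Sum.inr (i, j))

/-- Decoding a colour bit. [folklore] -/
@[simp] theorem bdec_cIdx {n : ℕ} (i c : Fin n) : bdec (cIdx i c) = Sum.inl (i, c) := by simp [cIdx]

/-- Decoding an adjacency bit. [folklore] -/
@[simp] theorem bdec_aIdx {n : ℕ} (i j : Fin n) : bdec (aIdx i j) = Sum.inr (i, j) := by simp [aIdx]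

/-- Every bit is a colour bit or an adjacency bit. [folklore] -/
theorem bit_cases {n : ℕ} (b : Fin (NB n)) : (∃ i c, b = cIdx i c) ∨ ∃ i j, b = aIdx i j := by
  rcases h : bdec b with ⟨i, c⟩ | ⟨i, j⟩
  · exact Or.inl ⟨i, c, by rw [cIdx, ← h, Equiv.symm_apply_apply]⟩
  · exact Or.inr ⟨i, j, by rw [aIdx, ← h, Equiv.symm_apply_apply]⟩

variable {V : Type*} [DecidableEq V] [Fintype V] (G : SimpleGraph V) [DecidableRel G.Adj] (n : ℕ)

/-! ### Encodings read along an enumeration -/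

/-- **The value of the coloured block read along `e`**: its first `s` rows are the vertices `e 0, …, e (s-1)`; row `i`
has the colour bit `col (e i)` and the adjacency bits of `G`; all other bits are `false`. [folklore] -/
def bitEnc (col : V → ℕ) (s : ℕ) (e : Fin n → V) : BVal n := fun b =>
  match bdec b with
  | .inl (i, c) => decide ((i : ℕ) < s ∧ col (e i) = c)
  | .inr (i, j) => decide ((i : ℕ) < s ∧ (j : ℕ) < s ∧ G.Adj (e i) (e j))

omit [DecidableEq V] [Fintype V] in
variable {G n} in
/-- The colour bits of an encoding. [folklore] -/
@[simp] theorem bitEnc_cIdx (col : V → ℕ) (s : ℕ) (e : Fin n → V) (i c : Fin n) :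
    bitEnc G n col s e (cIdx i c) = decide ((i : ℕ) < s ∧ col (e i) = c) := by
  simp [bitEnc]

omit [DecidableEq V] [Fintype V] in
variable {G n} in
/-- The adjacency bits of an encoding. [folklore] -/
@[simp] theorem bitEnc_aIdx (col : V → ℕ) (s : ℕ) (e : Fin n → V) (i j : Fin n) :
    bitEnc G n col s e (aIdx i j) = decide ((i : ℕ) < s ∧ (j : ℕ) < s ∧ G.Adj (e i) (e j)) := by
  simp [bitEnc]

/-- `e` ENUMERATES the block `A`: `|A| ≤ n`, the first `|A|` values lie in `A` and are distinct (hence are all of `A`).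
[folklore] -/
structure IsEnum (A : Finset V) (e : Fin n → V) : Prop where
  /-- the block fits -/
  card_le : A.card ≤ n
  /-- the first `|A|` values lie in `A` -/
  mem : ∀ i : Fin n, (i : ℕ) < A.card → e i ∈ A
  /-- … and are distinct -/
  inj : ∀ i j : Fin n, (i : ℕ) < A.card → (j : ℕ) < A.card → e i = e j → i = j

/-- SOME enumeration of the block of an instance (through `Finset.equivFin`; junk past `|A|`). [folklore] -/
noncomputable def someEnum (I : CGInst V) : Fin n → V := fun i =>
  if h : (i : ℕ) < I.1.1.card then (I.1.1.equivFin.symm ⟨i, h⟩ : V) else I.2.choose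

/-- WELL-FORMED instances: every colour inside the block is `< n` (all instances the process produces from a block of
`≤ n` vertices are well formed: `refineIn` values are `< |block|`). [folklore] -/
def Wf (I : CGInst V) : Prop := ∀ u ∈ I.1.1, I.1.2 u < n

/-- The value of a LEAF (and the designated junk value of an ill-formed instance): read along `someEnum`. [folklore] -/
noncomputable def leafVal (I : CGInst V) : BVal n := bitEnc G n I.1.2 I.1.1.card (someEnum n I)

open scoped Classical in
/-- **`E` is a GOOD value of `I`**: for a well-formed instance, `E` is its copy read along an enumeration of its block;
for an ill-formed one (never produced by the process), `E` is the designated junk value. [folklore] -/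
def Good (I : CGInst V) (E : BVal n) : Prop :=
  if Wf n I then ∃ e, IsEnum n I.1.1 e ∧ E = bitEnc G n I.1.2 I.1.1.card e else E = leafVal G n I

/-! ### Lifting at individualisation nodes -/

open scoped Classical in
/-- **LIFTING the value of the child at `x`** (`(A, refineIn G A (indiv col x))`) to a value of `(A, col)`: the colour
bit `(i, c)` of the lift holds iff row `i` has some child colour `c'` and the child class `c'` lies in the `col`-class
`c` (read through any member of the block); adjacency bits are kept. [folklore] -/
noncomputable def lift (I : CGInst V) (x : V) (E : BVal n) : BVal n :=
  if Wf n I then fun b =>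
    match bdec b with
    | .inl (i, c) => decide (∃ c' : Fin n, E (cIdx i c') = true ∧
        ∃ u ∈ I.1.1, refineIn G I.1.1 (indiv I.1.2 x) u = c' ∧ I.1.2 u = c)
    | .inr (i, j) => E (aIdx i j)
  else leafVal G n I

/-! ### Pasting at section nodes -/

section Paste

variable (I : CGInst V) (f : CGInst V → BVal n)

/-- Rows of the pasted value before the class of the part `J`: the total size of the parts of strictly smaller value.
[folklore] -/
noncomputable def ltCnt (J : CGInst V) : ℕ :=
  ∑ J' ∈ (cgParts G I).filter (fun J' => toLex (f J') < toLex (f J)), J'.1.1.card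

/-- The multiplicity of the value of the part `J` among the parts. [folklore] -/
noncomputable def mult (J : CGInst V) : ℕ := ((cgParts G I).filter fun J' => f J' = f J).card

/-- Row `i` of the pasted value is COVERED by the class of the part `J`: it lies in the `mult` consecutive copies of
`|J|` rows starting at row `ltCnt J`. [folklore] -/
def Covers (J : CGInst V) (i : ℕ) : Prop :=
  J ∈ cgParts G I ∧ ltCnt G n I f J ≤ i ∧ (i - ltCnt G n I f J) / J.1.1.card < mult G n I f J

/-- Colour bit `(i, c)` of the pasted value: row `i` is covered by the class of a part whose value has colour `c` at the
offset of `i`. [folklore] -/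
def PCol (i c : Fin n) : Prop :=
  ∃ J, Covers G n I f J i ∧ ∃ o : Fin n, (o : ℕ) = (i - ltCnt G n I f J) % J.1.1.card ∧ f J (cIdx o c) = true

/-- Rows `i` and `j` lie in the SAME COPY of the same class. [folklore] -/
def SameCopy (i j : Fin n) : Prop :=
  ∃ J, Covers G n I f J i ∧ Covers G n I f J j ∧
    (i - ltCnt G n I f J) / J.1.1.card = (j - ltCnt G n I f J) / J.1.1.card

/-- Adjacency bit `(i, j)` of the pasted value: inside one copy, the part's own bit at the two offsets; across copies,
the colour-level switching datum of the two row colours. [folklore] -/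
def PAdj (i j : Fin n) : Prop :=
  (∃ J, Covers G n I f J i ∧ Covers G n I f J j ∧
      (i - ltCnt G n I f J) / J.1.1.card = (j - ltCnt G n I f J) / J.1.1.card ∧
      ∃ o o' : Fin n, (o : ℕ) = (i - ltCnt G n I f J) % J.1.1.card ∧ (o' : ℕ) = (j - ltCnt G n I f J) % J.1.1.card ∧
        f J (aIdx o o') = true) ∨
  (¬ SameCopy G n I f i j ∧ ∃ c c' : Fin n, PCol G n I f i c ∧ PCol G n I f j c' ∧ SwCompC G I.1.1 I.1.2 c c')

open scoped Classical in
/-- **PASTING the values of the parts** of a section node (junk on ill-formed instances). [folklore] -/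
noncomputable def paste : BVal n :=
  if Wf n I then fun b =>
    match bdec b with
    | .inl (i, c) => decide (PCol G n I f i c)
    | .inr (i, j) => decide (PAdj G n I f i j)
  else leafVal G n I

end Paste

/-! ### Choice -/

/-- **CHOICE**: the lexicographically least value on offer. [folklore] -/
noncomputable def pick (S : Finset (BVal n)) : Option (BVal n) :=
  if h : S.Nonempty then some (ofLex ((S.image toLex).min' (h.image _))) else none

variable {n}

/-- The chosen value is on offer. [folklore] -/
theorem pick_mem (S : Finset (BVal n)) (E : BVal n) (h : pick n S = some E) : E ∈ S := by
  unfold pick at h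
  split_ifs at h with hS
  rw [Option.some.injEq] at h
  obtain ⟨E', hE', hEq⟩ := mem_image.1 (min'_mem (S.image toLex) (hS.image _))
  rw [← h, ← hEq]
  exact hE'

/-- Something is chosen from a non-empty offer. [folklore] -/
theorem pick_ne_none (S : Finset (BVal n)) (hS : S.Nonempty) : pick n S ≠ none := by
  unfold pick; rw [dif_pos hS]; exact Option.some_ne_none _

/-- The chosen value is the least on offer. [folklore] -/
theorem pick_le {S : Finset (BVal n)} {E : BVal n} (h : pick n S = some E) {E' : BVal n} (hE' : E' ∈ S) :
    toLex E ≤ toLex E' := by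
  unfold pick at h
  split_ifs at h with hS
  rw [Option.some.injEq] at h
  rw [← h]
  exact min'_le _ _ (mem_image_of_mem _ hE')

end CGBits

end Summit.PneNP.PneNP.Theorems
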